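import Summits.BirchSwinnertonDyer.Rank1Residual.Partition.Grid
import HarnessLib

/-!
# Partition lemma, part 2/5: the classification table is sound on all 36 864 cells (kernel `decide`)

HONEST FRAMING (cell `b2b-bsdres`, run/shared/lean/b2b/bsd-rank1-residual/, verbatim in every
file): the goal of the cell is to DELETE the COMBINATION-SHAPED residual classes of the
Birch–Swinnerton-Dyer formula for ALL analytic-rank `≤ 1` elliptic curves over `ℚ` — "full BSD
formula for every rank `≤ 1` curve in class `C`" assembled STRICTLY from published theorems — so
that the rank-`≤ 1` remainder becomes exactly the CONSTRUCTION-SHAPED classes, which are TYPED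
(missing-input `Prop`s), NOT attempted. This is not "finishing BSD".

Theorems only. `Cell.classify_sound` — checked by `decide +kernel` over the whole grid of part 1 —
says that the primary target named by `Cell.classify` (a covered row of RESIDUAL-CASES §a.1 or a
residual class of §a.2) really has its Boolean hypotheses satisfied on the cell, and that only
cells violating a consistency constraint are discarded; `Cell.grid_partition` is the finite
partition (every consistent cell is covered or residual). `Cell.v3_gap` / `Cell.v3_gap_exact` /
`Cell.v3_gap_witness` locate EXACTLY the cells that the tree's v3 classes X1–X12 alone would miss
(findings F1: the withdrawn-C4 domain, shape `f1Shape`, 48 cells, inside X11b; F2: surjective but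
not (im) at `p ≥ 5`, shape `f2Shape`, 64 cells, inside X9im, empty for real curves by Serre 1968
IV-23), and `Cell.c2Only_iff` characterises the cells covered ONLY by the PUB\* row C2 (finding F3).
Python mirror (second engine): HOME/b2b-bsdres-lit/g12/partition/grid.py reproduces every count.
-/

namespace Summit.BirchSwinnertonDyer.Rank1Residual

namespace Cell

/-- Raw form over the grid coordinates (the shape the kernel evaluates). [folklore] -/
theorem classify_sound_raw :
    ∀ (pk : PK) (red : RedK) (im : ImK) (bigIm : Bool) (rk : RK)
      (cm ram sst anom gvpar a3zero cmSplit cmRam : Bool),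
      (Cell.mk pk red im bigIm rk cm ram sst anom gvpar a3zero cmSplit cmRam).classifySound = true := by
  decide +kernel

/-- **The table is sound on all 36 864 cells**: the primary target's hypotheses hold on the cell;
`inconsistent` only off the consistency constraints. [folklore] -/
theorem classify_sound (c : Cell) : c.classifySound = true := by
  obtain ⟨pk, red, im, bigIm, rk, cm, ram, sst, anom, gvpar, a3zero, cmSplit, cmRam⟩ := c
  exact classify_sound_raw ..

/-- On a consistent cell the table never answers `inconsistent`. [folklore] -/
theorem classify_ne_inconsistent (c : Cell) (hc : c.consistent = true) :
    c.classify ≠ .inconsistent := by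
  intro h
  have hs := classify_sound c
  simp only [classifySound, h, Bool.not_eq_true', hc] at hs
  exact Bool.noConfusion hs

/-- **Grid partition**: every consistent cell is covered by a class-level row or lies in a
residual class. [folklore] -/
theorem grid_partition (c : Cell) (hc : c.consistent = true) :
    c.covered = true ∨ c.residual = true := by
  have h := classify_sound c
  unfold classifySound at h
  split at h
  · next r _ =>
    left
    cases r <;> simp only [Row.holds] at h <;> simp only [covered, h, Bool.or_true, Bool.true_or]
  · next x _ =>
    right
    cases x <;> simp only [XClass.holds] at h <;> simp only [residual, h, Bool.or_true, Bool.true_or]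
  · simp only [hc, Bool.not_true] at h
    exact absurd h Bool.false_ne_true

/-- Raw form of `v3_gap`. [folklore] -/
theorem v3_gap_raw :
    ∀ (pk : PK) (red : RedK) (im : ImK) (bigIm : Bool) (rk : RK)
      (cm ram sst anom gvpar a3zero cmSplit cmRam : Bool),
      (Cell.mk pk red im bigIm rk cm ram sst anom gvpar a3zero cmSplit cmRam).v3GapSpec = true := by
  decide +kernel

/-- Raw form of `v3_gap_exact`. [folklore] -/
theorem v3_gap_exact_raw :
    ∀ (pk : PK) (red : RedK) (im : ImK) (bigIm : Bool) (rk : RK)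
      (cm ram sst anom gvpar a3zero cmSplit cmRam : Bool),
      (Cell.mk pk red im bigIm rk cm ram sst anom gvpar a3zero cmSplit cmRam).v3GapExact = true := by
  decide +kernel

/-- **F1/F2**: with the tree's v3 classes X1–X12 alone, a consistent cell escaping every class-level
row and every class has shape F1 = `(mult, irr, r = 1, ram, sst, p ≥ 5, ¬cm)` (the withdrawn C4's
domain; it lies in X11b) or shape F2 = `(¬cm, ord, p ≥ 5, surj, ¬(im), …)` (empty for real curves by
Serre 1968 IV-23; it lies in X9im). 48 + 64 = 112 of the 13 952 consistent cells. [folklore] -/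
theorem v3_gap (c : Cell) (hc : c.consistent = true)
    (h : ¬ (c.covered = true ∨ c.residualV3 = true)) :
    (c.f1Shape = true ∧ c.x11b = true) ∨ (c.f2Shape = true ∧ c.x9im = true) := by
  obtain ⟨pk, red, im, bigIm, rk, cm, ram, sst, anom, gvpar, a3zero, cmSplit, cmRam⟩ := c
  have hg := v3_gap_raw pk red im bigIm rk cm ram sst anom gvpar a3zero cmSplit cmRam
  simp only [v3GapSpec, Bool.or_eq_true, Bool.and_eq_true, Bool.not_eq_true', Bool.and_eq_false_imp,
    Bool.not_eq_false'] at hg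
  rcases hg with hg | hg
  · exact absurd (hg hc) h
  · exact hg

/-- Converse of `v3_gap`: every consistent cell of shape F1 or F2 escapes every row and every v3
class. [folklore] -/
theorem v3_gap_exact (c : Cell) (hc : c.consistent = true)
    (h : c.f1Shape = true ∨ c.f2Shape = true) : ¬ (c.covered = true ∨ c.residualV3 = true) := by
  obtain ⟨pk, red, im, bigIm, rk, cm, ram, sst, anom, gvpar, a3zero, cmSplit, cmRam⟩ := c
  have hg := v3_gap_exact_raw pk red im bigIm rk cm ram sst anom gvpar a3zero cmSplit cmRam
  simp only [v3GapExact, Bool.or_eq_true, Bool.not_eq_true', Bool.and_eq_false_imp,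
    Bool.or_eq_false_iff] at hg
  rcases hg with hg | hg
  · exact absurd h (by simpa [not_or] using hg hc)
  · simpa [not_or] using hg

/-- **F1 witness**: the cell `(p ≥ 5, mult, surj, r = 1, ¬cm, ram, sst)` is consistent, in no
class-level row and in none of the tree's v3 classes X1–X12 (it is the withdrawn C4's domain);
it IS in X11b. [folklore] -/
theorem v3_gap_witness :
    (⟨.ge5, .mult, .surj, true, .one, false, true, true, false, false, false, false, false⟩ : Cell).consistent
      = true ∧
    (⟨.ge5, .mult, .surj, true, .one, false, true, true, false, false, false, false, false⟩ : Cell).covered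
      = false ∧
    (⟨.ge5, .mult, .surj, true, .one, false, true, true, false, false, false, false, false⟩ : Cell).residualV3
      = false ∧
    (⟨.ge5, .mult, .surj, true, .one, false, true, true, false, false, false, false, false⟩ : Cell).x11b
      = true := by
  decide

/-- Raw form of `c2Only_iff`. [folklore] -/
theorem c2Only_iff_raw :
    ∀ (pk : PK) (red : RedK) (im : ImK) (bigIm : Bool) (rk : RK)
      (cm ram sst anom gvpar a3zero cmSplit cmRam : Bool),
      (Cell.mk pk red im bigIm rk cm ram sst anom gvpar a3zero cmSplit cmRam).c2OnlySpec = true := by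
  decide +kernel

/-- **F3**: the consistent cells covered ONLY by the PUB\* row C2 and lying in no residual class are
exactly `¬cm ∧ p ≥ 5 ∧ ord ∧ (im) ∧ surj ∧ ((r = 0 ∧ ¬ram) ∨ (r = 1 ∧ ¬sst))` (the cells with
(im) ∧ irr ∧ ¬surj are inconsistent). [folklore] -/
theorem c2Only_iff (c : Cell) :
    c.c2Only = (c.consistent && !c.cm && c.ge5 && c.goodOrd && c.bigIm && c.surj &&
      ((c.r0 && !c.ram) || (c.r1 && !c.sst))) := by
  obtain ⟨pk, red, im, bigIm, rk, cm, ram, sst, anom, gvpar, a3zero, cmSplit, cmRam⟩ := c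
  have h := c2Only_iff_raw pk red im bigIm rk cm ram sst anom gvpar a3zero cmSplit cmRam
  simpa only [c2OnlySpec, beq_iff_eq] using h

end Cell

end Summit.BirchSwinnertonDyer.Rank1Residual
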